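import Summits.Ventures.HodgeRepro.Tier3EigenDictionary

/-!
# LEMMA R's non-vanishing END TO END on the kernel: from the eigenbasis data, through the eigen-coordinate
dictionary, to «`e · m^* η ≠ 0` on every `σ`-line» of night-1's model

Blind re-derivation cell `pub-hodge-repro`, seat `t3-p4` (Tier 3, T3.5 for T3.4).  Target tree path
`lean/Summits/Ventures/HodgeRepro/Tier3LemmaRNonvanishing.lean`; imports the cell's `Tier3EigenDictionary` (hence
`Tier3WedgeChain`, `Tier3WedgeBaseChange`, `Tier3EigenBasis`, `Tier3OrbitPullback` and night-1's
`Night1ReducedPullback`: `pullLin`, `twistMap`, `lineEnum`, `wedgeComponent`, `weilWedgeProd`, `reducedSet`).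

WHAT THIS FILE STATES.  LEMMA-R-RESIDUE.md §5 is spread over `Tier3WedgeChain.exists_eigenbasis_wedge_chain`
(the abstract rows: a non-zero rational `η` with every orbit coefficient `c_U ≠ 0`), the dictionary of
`Tier3EigenDictionary` (the coefficients transfer to the coordinate wedges up to units) and
`Tier3OrbitPullback` (the `σ`-component of `m^* (Σ c_U e_U)` is `c_{U_σ} · (±1) · w_σ`).  Here they are composed
into ONE theorem:

* `exists_rational_wedge_of_orbit_mem` — `Tier3WedgeBaseChange.exists_rational_wedge_of_orbit` with its
  Galois-stability / orbit hypotheses at membership level (a technical wrapper: a caller whose context carries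
  other `DecidableEq` instances on `J × Gal` never has to match the `MulAction` on `Set.powersetCard`);
* `mem_reducedSet_mul_iff` — the reduced sets are left-translation-equivariant, `p ∈ U_{τσ} ⟺ ∃ q ∈ U_σ, τ • q = p`;
  `image_ofFinEmbEquiv_symm` — the canonical enumeration of an `n`-set enumerates it;
* **`exists_rational_class_wedgeComponent_map_pullLin_ne_zero`** — LEMMA R's NON-VANISHING END TO END: from the
  eigenbasis data (a finite Galois `K/F₀` = `F/ℚ`, `V` = `H¹(B_red, ℚ)` with its `K`-basis `ω : J → V`, the
  diagonal `K^J`-action `A`, a face `(cls, tw)` with `(cls, tw)` injective — twists pairwise distinct within a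
  class — and `|ι| = 2k`), there are the eigenbasis `e`, the base-change isomorphism `Φ` and the wedge basis `E`
  such that for EVERY eigen-coordinate identification `Ψ` (`Tier3EigenDictionary.exists_eigenCoordinates`: they
  exist), every base-change isomorphism `Φ₂` of the wedge space and every `F₀`-subspace `W` containing the wedges
  of the reduced sets `U_σ` after base change (Pohlmann's lines — PRINTED, M1 p0003:L68–L82, the only input left
  on paper), there is a NON-ZERO `η ∈ W` whose image class on the model has a non-zero `lineSet σ`-component after
  pull-back along the twist map for EVERY `σ`: «`e · m^* η = Σ_U c_U Σ_σ (± w_σ) ≠ 0`» with the dictionary inside.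

HONESTY.  Linear algebra on the cell's own kernel modules; no definition is introduced; nothing geometric is
built — that `Ψ` is the identification of `H¹(B_red) ⊗ ℂ` with eigen-coordinates, that `pullLin (twistMap cls tw)`
is `m^*`, and Pohlmann's theorem stay on paper / in print exactly as LEMMA-R-RESIDUE.md §7 lists them.  HC_CM is
NOT proved by anyone in this repository.
-/

set_option autoImplicit false

open TensorProduct Finset
open scoped Pointwise

namespace HodgeRepro.Tier3

open HodgeRepro.RouteC HodgeRepro.CMHodgeOn

variable {F₀ K : Type*} [Field F₀] [Field K] [Algebra F₀ K]
variable {V : Type*} [AddCommGroup V] [Module K V] [Module F₀ V] [IsScalarTower F₀ K V]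
variable {J : Type*} [Fintype J]

section OrbitMem

variable [FiniteDimensional F₀ K] [IsGalois F₀ K]

omit [Fintype J] [Module K V] [IsScalarTower F₀ K V] in
/-- `Tier3WedgeBaseChange.exists_rational_wedge_of_orbit` with its Galois-stability and orbit hypotheses stated at
the level of MEMBERSHIP (`σ • s = s'` ⟺ `∀ p, p ∈ s' ↔ ∃ q ∈ s, σ • q = p`), so that a caller whose context
carries other `DecidableEq` instances on `ι` never has to match the `MulAction` on `Set.powersetCard ι n`. -/
theorem exists_rational_wedge_of_orbit_mem {ι : Type*} [LinearOrder ι] [MulAction (K ≃ₐ[F₀] K) ι] (n : ℕ)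
    (e : Module.Basis ι K (K ⊗[F₀] V))
    (hequiv : ∀ (σ : K ≃ₐ[F₀] K) (i : ι), LinearMap.rTensor V σ.toLinearMap (e i) = e (σ • i))
    (Φ : K ⊗[F₀] ⋀[F₀]^n V ≃ₗ[K] ⋀[K]^n (K ⊗[F₀] V))
    (hΦ : ∀ (k : K) (v : Fin n → V),
      Φ (k ⊗ₜ[F₀] exteriorPower.ιMulti F₀ n v) = k • exteriorPower.ιMulti K n (fun i => (1 : K) ⊗ₜ[F₀] v i))
    (W : Submodule F₀ (⋀[F₀]^n V)) (P : Set (Set.powersetCard ι n))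
    (hP : ∀ (σ : K ≃ₐ[F₀] K), ∀ s ∈ P, ∃ s' ∈ P, ∀ p : ι, p ∈ s' ↔ ∃ q ∈ s, σ • q = p)
    (hPW : ∀ s ∈ P, ((e.exteriorPower n).map Φ.symm) s ∈ W.baseChange K)
    (s₀ : Set.powersetCard ι n) (hs₀ : s₀ ∈ P) :
    ∃ η : ⋀[F₀]^n V, η ∈ W ∧ η ≠ 0 ∧
      ∀ s : Set.powersetCard ι n, (∃ σ : K ≃ₐ[F₀] K, ∀ p : ι, p ∈ s ↔ ∃ q ∈ s₀, σ • q = p) →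
        ((e.exteriorPower n).map Φ.symm).repr ((1 : K) ⊗ₜ[F₀] η) s ≠ 0 := by
  have hsmul : ∀ (σ : K ≃ₐ[F₀] K) (s s' : Set.powersetCard ι n),
      (∀ p : ι, p ∈ s' ↔ ∃ q ∈ s, σ • q = p) → σ • s = s' := by
    intro σ s s' h
    refine Subtype.ext (Finset.ext fun p => ?_)
    rw [Set.powersetCard.coe_smul, Finset.mem_smul_finset]
    exact (h p).symm
  have hP' : ∀ (σ : K ≃ₐ[F₀] K), ∀ s ∈ P, σ • s ∈ P := by
    intro σ s hs
    obtain ⟨s', hs', h⟩ := hP σ s hs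
    rw [hsmul σ s s' h]
    exact hs'
  obtain ⟨η, hηW, hη0, -, hcoef⟩ := exists_rational_wedge_of_orbit n e hequiv Φ hΦ W P hP' hPW s₀ hs₀
  refine ⟨η, hηW, hη0, fun s ⟨σ, h⟩ => hcoef s ?_⟩
  exact MulAction.mem_orbit_iff.mpr ⟨σ, hsmul σ s₀ s h⟩

end OrbitMem

section EndToEnd

variable [FiniteDimensional F₀ K] [IsGalois F₀ K]
variable [Algebra K ℂ] [DecidableEq J] [DecidableEq (K ≃ₐ[F₀] K)]
variable {ι : Type*} [Fintype ι] [DecidableEq ι]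

omit [Fintype J] [Module K V] [IsScalarTower F₀ K V] [FiniteDimensional F₀ K] [IsGalois F₀ K] [Algebra K ℂ]
  [DecidableEq ι] in
/-- The reduced sets are left-translation-equivariant, membership-wise: `p ∈ U_{τσ} ⟺ ∃ q ∈ U_σ, τ • q = p` for
the action of `Gal(K/F₀)` on `J × Gal(K/F₀)` by left multiplication on the second factor. -/
theorem mem_reducedSet_mul_iff [MulAction (K ≃ₐ[F₀] K) (J × (K ≃ₐ[F₀] K))]
    (hact : ∀ (σ x : K ≃ₐ[F₀] K) (j : J), σ • (j, x) = (j, σ * x))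
    (cls : ι → J) (tw : ι → K ≃ₐ[F₀] K) (τ σ : K ≃ₐ[F₀] K) (p : J × (K ≃ₐ[F₀] K)) :
    p ∈ reducedSet cls tw (τ * σ) ↔ ∃ q ∈ reducedSet cls tw σ, τ • q = p := by
  simp only [mem_reducedSet]
  constructor
  · rintro ⟨i, rfl⟩
    exact ⟨(cls i, σ * (tw i)⁻¹), ⟨i, rfl⟩, by rw [hact, mul_assoc]⟩
  · rintro ⟨q, ⟨i, rfl⟩, rfl⟩
    exact ⟨i, by rw [hact, mul_assoc]⟩

omit [Fintype J] [Module K V] [IsScalarTower F₀ K V] [FiniteDimensional F₀ K] [IsGalois F₀ K] [Algebra K ℂ]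
  [DecidableEq ι] [Fintype ι] in
/-- The canonical enumeration of `s ∈ Set.powersetCard ι n` enumerates `s`. -/
theorem image_ofFinEmbEquiv_symm {n : ℕ} [LinearOrder (J × (K ≃ₐ[F₀] K))]
    (s : Set.powersetCard (J × (K ≃ₐ[F₀] K)) n) :
    Finset.univ.image (Set.powersetCard.ofFinEmbEquiv.symm s) = (s : Finset (J × (K ≃ₐ[F₀] K))) := by
  ext p
  rw [Finset.mem_image]
  constructor
  · rintro ⟨i, -, rfl⟩
    exact (Set.powersetCard.mem_range_ofFinEmbEquiv_symm_iff_mem s _).mp ⟨i, rfl⟩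
  · intro hp
    obtain ⟨i, hi⟩ := (Set.powersetCard.mem_range_ofFinEmbEquiv_symm_iff_mem s p).mpr hp
    exact ⟨i, Finset.mem_univ i, hi⟩

/-- **LEMMA R's non-vanishing, end to end on the kernel** (LEMMA-R-RESIDUE.md §5 with its dictionary line).
Data: a finite Galois extension `K/F₀` (`F/ℚ`), a `K`-space `V` with `K`-basis `ω : J → V` (`H¹(B_red, ℚ)` with its
`F`-generators), the diagonal action `A` of the CM algebra `K^J` on `ω`, a face `(cls, tw)` with injective
`(cls, tw)` and `|ι| = 2k` (`e₀`), and the action of `Gal(K/F₀)` on `J × Gal(K/F₀)` by left multiplication.  Then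
there are the eigenbasis `e` (Galois-equivariant, `K^J`-eigen), the base-change isomorphism `Φ` and the wedge basis
`E` with `Φ (E_s) = e_{s₁} ∧ ⋯ ∧ e_{s_{2k}}` such that, for EVERY identification `Ψ` of `ℂ ⊗ H¹` with the
coordinate model `ℂ^{J × Gal}` intertwining `K^J` with its character torus (eigen-coordinates), every base-change
isomorphism `Φ₂` of the wedge space, and every `F₀`-subspace `W ≤ ⋀^{2k} V` containing the wedges of the reduced
sets `U_σ` after base change (Pohlmann's lines — PRINTED, the only input left on paper), there is a NON-ZERO `η ∈ W`
whose image class on the model has, for EVERY `σ`, a non-zero `lineSet σ`-component after pull-back along the twist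
map: «`e · m^* η ≠ 0` on every `σ`-line». -/
theorem exists_rational_class_wedgeComponent_map_pullLin_ne_zero {k : ℕ}
    (cls : ι → J) (tw : ι → K ≃ₐ[F₀] K) (hinj : Function.Injective fun i => (cls i, tw i))
    (e₀ : Fin (2 * k) ≃ ι)
    (ω : Module.Basis J K V) (A : (J → K) → V →ₗ[K] V) (hA : ∀ (b : J → K) (j : J), A b (ω j) = b j • ω j)
    [LinearOrder (J × (K ≃ₐ[F₀] K))] [MulAction (K ≃ₐ[F₀] K) (J × (K ≃ₐ[F₀] K))]
    (hact : ∀ (σ x : K ≃ₐ[F₀] K) (j : J), σ • (j, x) = (j, σ * x)) :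
    ∃ (e : Module.Basis (J × (K ≃ₐ[F₀] K)) K (K ⊗[F₀] V))
      (E : Module.Basis (Set.powersetCard (J × (K ≃ₐ[F₀] K)) (2 * k)) K (K ⊗[F₀] ⋀[F₀]^(2 * k) V))
      (Φ : K ⊗[F₀] ⋀[F₀]^(2 * k) V ≃ₗ[K] ⋀[K]^(2 * k) (K ⊗[F₀] V)),
      (∀ (σ x : K ≃ₐ[F₀] K) (j : J), LinearMap.rTensor V σ.toLinearMap (e (j, x)) = e (j, σ * x)) ∧
      (∀ (x : K ≃ₐ[F₀] K) (j : J) (b : J → K),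
        LinearMap.lTensor K ((A b).restrictScalars F₀) (e (j, x)) = x (b j) • e (j, x)) ∧
      (∀ (c : K) (v : Fin (2 * k) → V),
        Φ (c ⊗ₜ[F₀] exteriorPower.ιMulti F₀ (2 * k) v) =
          c • exteriorPower.ιMulti K (2 * k) (fun i => (1 : K) ⊗ₜ[F₀] v i)) ∧
      (∀ s, Φ (E s) = exteriorPower.ιMulti_family K (2 * k) e s) ∧
      ∀ (Ψ : ℂ ⊗[K] (K ⊗[F₀] V) ≃ₗ[ℂ] (J × (K ≃ₐ[F₀] K) → ℂ)),
        (∀ (b : J → K) (z : ℂ ⊗[K] (K ⊗[F₀] V)),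
          Ψ (LinearMap.baseChange ℂ (LinearMap.baseChange K ((A b).restrictScalars F₀)) z) =
            torusOn (fun p : J × (K ≃ₐ[F₀] K) => algebraMap K ℂ (p.2 (b p.1))) (Ψ z)) →
        ∀ (Φ₂ : ℂ ⊗[K] ⋀[K]^(2 * k) (K ⊗[F₀] V) ≃ₗ[ℂ] ⋀[ℂ]^(2 * k) (ℂ ⊗[K] (K ⊗[F₀] V))),
          (∀ (c : ℂ) (v : Fin (2 * k) → K ⊗[F₀] V),
            Φ₂ (c ⊗ₜ[K] exteriorPower.ιMulti K (2 * k) v) =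
              c • exteriorPower.ιMulti ℂ (2 * k) (fun i => (1 : ℂ) ⊗ₜ[K] v i)) →
          ∀ (W : Submodule F₀ (⋀[F₀]^(2 * k) V)),
            (∀ s : Set.powersetCard (J × (K ≃ₐ[F₀] K)) (2 * k),
              (∃ σ, (s : Finset (J × (K ≃ₐ[F₀] K))) = reducedSet cls tw σ) → E s ∈ W.baseChange K) →
            ∃ η ∈ W, η ≠ 0 ∧ ∀ σ : K ≃ₐ[F₀] K,
              wedgeComponent (lineEnum e₀ σ)
                (exteriorPower.map (2 * k) (pullLin (twistMap cls tw))
                  (exteriorPower.map (2 * k) (Ψ : ℂ ⊗[K] (K ⊗[F₀] V) →ₗ[ℂ] (J × (K ≃ₐ[F₀] K) → ℂ))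
                    (Φ₂ (LinearMap.baseChange ℂ
                      (Φ : K ⊗[F₀] ⋀[F₀]^(2 * k) V →ₗ[K] ⋀[K]^(2 * k) (K ⊗[F₀] V))
                      ((1 : ℂ) ⊗ₜ[K] ((1 : K) ⊗ₜ[F₀] η)))))) ≠ 0 := by
  classical
  obtain ⟨e, he1, -, he3⟩ := exists_equivariant_eigenbasis_diag (F₀ := F₀) ω A hA
  have hequiv : ∀ (σ : K ≃ₐ[F₀] K) (i : J × (K ≃ₐ[F₀] K)),
      LinearMap.rTensor V σ.toLinearMap (e i) = e (σ • i) := by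
    rintro σ ⟨j, x⟩
    rw [hact, he1]
  obtain ⟨Φ, hΦ⟩ := exists_wedgeBaseChange (F₀ := F₀) (K := K) (V := V) (2 * k)
  have hE : ∀ s, Φ (((e.exteriorPower (2 * k)).map Φ.symm) s) = exteriorPower.ιMulti_family K (2 * k) e s := by
    intro s
    rw [Module.Basis.map_apply, LinearEquiv.apply_symm_apply, exteriorPower.basis_apply]
  refine ⟨e, (e.exteriorPower (2 * k)).map Φ.symm, Φ, he1, he3, hΦ, hE, ?_⟩
  intro Ψ hΨ Φ₂ hΦ₂ W hPW
  -- the units of the dictionary on `H¹`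
  have hdict := fun p : J × (K ≃ₐ[F₀] K) => exists_unit_dictionary A e he3 Ψ hΨ p.1 p.2
  choose u hu0 hu using hdict
  -- the Galois-stable set of reduced sets and its base point `U_1`
  have hcard : ∀ σ : K ≃ₐ[F₀] K, (reducedSet cls tw σ).card = 2 * k := by
    intro σ
    rw [card_reducedSet cls tw hinj σ, Fintype.card_congr e₀.symm, Fintype.card_fin]
  let P : Set (Set.powersetCard (J × (K ≃ₐ[F₀] K)) (2 * k)) :=
    {s | ∃ σ, (s : Finset (J × (K ≃ₐ[F₀] K))) = reducedSet cls tw σ}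
  let U : (K ≃ₐ[F₀] K) → Set.powersetCard (J × (K ≃ₐ[F₀] K)) (2 * k) :=
    fun σ => ⟨reducedSet cls tw σ, Set.powersetCard.mem_iff.mpr (hcard σ)⟩
  have hUP : ∀ σ, U σ ∈ P := fun σ => ⟨σ, rfl⟩
  have hmemU : ∀ (σ : K ≃ₐ[F₀] K) (p : J × (K ≃ₐ[F₀] K)), p ∈ U σ ↔ p ∈ reducedSet cls tw σ :=
    fun _ _ => Iff.rfl
  have hP : ∀ (τ : K ≃ₐ[F₀] K), ∀ s ∈ P, ∃ s' ∈ P, ∀ p, p ∈ s' ↔ ∃ q ∈ s, τ • q = p := by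
    rintro τ s ⟨σ, hs⟩
    refine ⟨U (τ * σ), hUP _, fun p => ?_⟩
    rw [hmemU, mem_reducedSet_mul_iff hact cls tw τ σ p]
    constructor
    · rintro ⟨q, hq, rfl⟩
      exact ⟨q, by rw [← Set.powersetCard.mem_coe_iff, hs]; exact hq, rfl⟩
    · rintro ⟨q, hq, rfl⟩
      exact ⟨q, by rw [← Set.powersetCard.mem_coe_iff, hs] at hq; exact hq, rfl⟩
  obtain ⟨η, hηW, hη0, hcoef⟩ :=
    exists_rational_wedge_of_orbit_mem (2 * k) e hequiv Φ hΦ W P hP hPW (U 1) (hUP 1)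
  have hcoefU : ∀ σ, ((e.exteriorPower (2 * k)).map Φ.symm).repr ((1 : K) ⊗ₜ[F₀] η) (U σ) ≠ 0 := by
    intro σ
    refine hcoef (U σ) ⟨σ, fun p => ?_⟩
    simp only [hmemU]
    have := mem_reducedSet_mul_iff hact cls tw σ 1 p
    rwa [mul_one] at this
  refine ⟨η, hηW, hη0, fun σ => ?_⟩
  rw [map_baseChange_tmul_eq_sum_smul_coordWedgeOn (2 * k) Φ e _ hE Φ₂ hΦ₂ Ψ u hu, map_sum, map_sum]
  simp only [LinearMap.map_smul]
  rw [Finset.sum_eq_single_of_mem (U σ) (Finset.mem_univ _)]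
  · -- the `U_σ`-term is a non-zero multiple of the `σ`-line
    obtain ⟨π, hπ⟩ := coordWedgeOn_eq_sign_smul_of_image_eq (reducedEnum_injective hinj e₀ σ)
      (Set.powersetCard.ofFinEmbEquiv.symm (U σ)).injective
      (by rw [image_reducedEnum, image_ofFinEmbEquiv_symm])
    rw [hπ, LinearMap.map_smul, LinearMap.map_smul, wedgeComponent_lineEnum_map_pullLin_reducedWedge hinj e₀ σ,
      smul_smul]
    refine smul_ne_zero (mul_ne_zero (mul_ne_zero ?_ ?_) ?_) (weilWedgeProd_ne_zero e₀ σ)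
    · exact (map_ne_zero (algebraMap K ℂ)).mpr (hcoefU σ)
    · exact Finset.prod_ne_zero_iff.mpr fun i _ => hu0 _
    · rcases Int.units_eq_one_or (Equiv.Perm.sign π) with h | h <;> simp [h]
  · -- every other term vanishes: its set is not `U_σ`
    intro s _ hs
    rw [wedgeComponent_lineEnum_map_pullLin_coordWedgeOn_of_ne e₀ σ
      (Set.powersetCard.ofFinEmbEquiv.symm s).injective, smul_zero]
    rw [image_ofFinEmbEquiv_symm]
    intro h
    exact hs (Subtype.ext h)

end EndToEnd

end HodgeRepro.Tier3
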